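import Summits.BirchSwinnertonDyer.BirchSwinnertonDyer.Theorems.EisensteinPrimesMazurMCOnCellBTwistbackKLFlatPartnerUnitsPsi
import Summits.BirchSwinnertonDyer.BirchSwinnertonDyer.Theorems.EisensteinPrimesLineCharactersWeilRelation
import HarnessLib

/-!
# Crux 3 `MazurMCOnCellB` (stmt-BirchSwinnertonDyer-19033), line `twistback` v4 — the KL-flat door with BOTH
# per-pair character hypotheses DISCHARGED: `ψ(p) ≠ 1` (brick (F3)) and the Weil relation `φψ = ω`
# (brick (F3″))

Width seat bsd-line-x2-p1-w7 (g0). HONEST FRAMING (cell `bsd-eis`, run/shared/lean/pub/bsd-eis/): conditional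
theorems only — inputs BY NAME as in LEAD g10's p645771: the route's `PublishedInputs` (stmt-…-19037), Disegni
2020 Thm. 4(1) (PUB), Greenberg–Vatsal Thm. (3.11)+(28) (PUB, F1), and PER PAIR the line datum with PRIMITIVE
presentations, ONE Bernoulli unit, local balance `1` (+ STEP L and one admissible `K` for §2); nothing booked;
no main conjecture / BSD proved for any curve unconditionally; no summit statement is proved; 0 cells / labels /
tiers move. No `def`, no named fact, no `sorry`.

WHAT. `…KLFlatPartnerUnitsPsi` (p650639) = p645771 §2/§3 without `ψ(p) ≠ 1`; here additionally WITHOUT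
`hφψ : ∀ a, ¬ p ∣ a → φ(a)·a⁻¹ = ψ⁻¹(a)`, supplied by
`EisensteinPrimesLineCharactersWeilRelation.apply_natCast_mul_inv_eq_inv_apply` from `hΦ`, `hφ0`, `hψ0` and
the primitivity of `φ`, `ψ` (all already binders):

* §1 `missingUpperBoundAt_of_cellC_of_not_split_of_bernoulliUnit_isogenous''` — PER PARTNER (X2c, non-split):
  `BSD(V, ℓ) ∧ Upper(V, ℓ)` from a ramified-even line on an isogenous carrier with primitive presentations, ONE
  unit `‖B₁^{(d)}(ω̃∘ψ⁻¹)‖_ℓ = 1`, local balance `1`;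
* §2 `mazurMainConjectureAt_of_cellB_of_not_split_of_indexLowerBoundAt_of_bernoulliUnit_twist''` — PER PAIR (X2b,
  non-split): Mazur's MC at `(W, p)` from STEP L at ONE Heegner datum, ONE admissible `K` (`r_an(E^{(d_K)}) = 1`),
  a carrier isogenous to the twist with a ramified-even line and primitive presentations, ONE Bernoulli unit
  (`p ∤ h(−d)` for quadratic `ψ`, w3 g7), local balance `1`. PER-PAIR CHARACTER-LEVEL INPUTS LEFT: NONE beyond
  the presentation itself.

References: [GreenbergVatsal2000] §2 pp. 14–15, p. 28, §3 Thm. (3.11) p. 43; [SilvermanCSS1997] Ch. II §7–§8;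
[SilvermanATAEC1994] Ch. V §5; [Washington1997] Thm. 5.11; [Disegni2020] Thm. 4 (§3.2); [Wuthrich2014] Thm. 16;
[JetchevSkinnerWan2017] §7.4.1.
-/

set_option autoImplicit false

-- `Summit.BirchSwinnertonDyer.BirchSwinnertonDyer.…`: the summit and its single sub-problem share a name.
set_option linter.dupNamespace false

noncomputable section

open scoped Classical MatrixGroups ModularForm

open CongruenceSubgroup WeierstrassCurve NumberField IsDedekindDomain Field PowerSeries
  Literature.NumberTheory.EllipticCurves
  Literature.NumberTheory.GaloisRepresentations
  Literature.NumberTheory.EllipticCurves.ModularForms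
  Literature.NumberTheory.QuadraticFields
  Literature.NumberTheory.EllipticCurves.Rank1Residual
  Literature.NumberTheory.EllipticCurves.Rank1Residual.Typed
  Literature.NumberTheory.EllipticCurves.GreenbergVatsal2000
  Literature.NumberTheory.EllipticCurves.Disegni2020
  Summit.BirchSwinnertonDyer.Rank1Residual
  Summit.BirchSwinnertonDyer.BirchSwinnertonDyer.Theses
  Summit.BirchSwinnertonDyer.BirchSwinnertonDyer.Theorems.EisensteinPrimesMazurMCOnCellBTwistbackKLFlatPartnerUnitsPsi
  Summit.BirchSwinnertonDyer.BirchSwinnertonDyer.Theorems.EisensteinPrimesLineCharactersWeilRelation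

namespace Summit.BirchSwinnertonDyer.BirchSwinnertonDyer.Theorems.EisensteinPrimesMazurMCOnCellBTwistbackKLFlatPartnerUnitsWeil

/-! ## §1. PER PARTNER: the upper half from ONE Bernoulli unit — `ψ(ℓ) ≠ 1` and `φψ = ω` discharged -/

/-- **PER PARTNER, NON-SPLIT: `BSD(V, ℓ)` and its upper half from a ramified-even line datum on an isogenous
carrier with ONE Bernoulli unit — WITHOUT the hypotheses `ψ(ℓ) ≠ 1` and `φ(a)a⁻¹ = ψ⁻¹(a)`** (p650639 §1 with
the Weil relation supplied by `EisensteinPrimesLineCharactersWeilRelation.apply_natCast_mul_inv_eq_inv_apply`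
from the PRIMITIVE presentations `φ`, `ψ` of the line).
[cite: GreenbergVatsal2000, §3 Thm. (3.11) (p. 43) with (26)–(28) and §2 pp. 14–15, 28] [cite: Wuthrich2014, Thm. 16 (p. 397)]
[cite: Disegni2020, Thm. 4 (§3.2)] [cite: SilvermanATAEC1994, Ch. V Lemma 5.2 (c), Thm. 5.3 (a),(b), Cor. 5.4 (held copy PDF pp. 406–410)] -/
theorem missingUpperBoundAt_of_cellC_of_not_split_of_bernoulliUnit_isogenous''
    (hP : EisensteinPrimes.PublishedInputs)
    (hDis : padicBSD_rankOne_nonsplitMult) (h311 : thm311_hasUnitContent_iff_and_order_eq_of_lineRamifiedEven)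
    (V : WeierstrassCurve ℚ) [V.IsElliptic] [V.IsGloballyMinimal] (ℓ : ℕ) [Fact ℓ.Prime]
    (hcV : X2.CellC V ℓ) (hns : ¬ V.HasSplitMultiplicativeReductionAtPrime ℓ)
    (V' : WeierstrassCurve ℚ) [V'.IsElliptic] [V'.IsGloballyMinimal] (hiso : IsIsogenous V V')
    (S₀ : Finset (HeightOneSpectrum (𝓞 ℚ))) (Φ₀ : AddSubgroup (V'.geomTorsion (ℓ : ℤ)))
    (m : ℕ) [NeZero m] (φ : DirichletCharacter (ZMod ℓ) m)
    (d : ℕ) [NeZero d] (ψ : DirichletCharacter (ZMod ℓ) d)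
    (hΦ : IsRationalLine V' ℓ Φ₀) (hram : ¬ LineUnramifiedAt V' ℓ Φ₀) (heven : LineEven V' ℓ Φ₀)
    (hφ : φ.IsPrimitive) (hψ : ψ.IsPrimitive) (hℓm : ℓ ∣ m) (hℓd : ¬ ℓ ∣ d)
    (hφ0 : ∀ (σ : absoluteGaloisGroup ℚ), ∀ P ∈ Φ₀,
      σ • P = (φ ((modNCyclotomicCharacter ℚ m σ : (ZMod m)ˣ) : ZMod m)).val • P)
    (hψ0 : ∀ (σ : absoluteGaloisGroup ℚ) (P : V'.geomTorsion (ℓ : ℤ)),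
      σ • P - (ψ ((modNCyclotomicCharacter ℚ d σ : (ZMod d)ˣ) : ZMod d)).val • P ∈ Φ₀)
    (hS₀p : ∀ v ∈ S₀, ((ℓ : ℕ) : 𝓞 ℚ) ∉ v.asIdeal)
    (hS : ∀ v : HeightOneSpectrum (𝓞 ℚ), v ∉ S₀ → ((ℓ : ℕ) : 𝓞 ℚ) ∉ v.asIdeal → V'.HasGoodReductionAt v)
    (hB : ‖twistedBernoulli ℓ 1 d (fun a : ℕ ↦ teichmullerLift ℓ (ψ (a : ZMod d))⁻¹)‖ = 1)
    (hbal : 1 + ∑ v ∈ S₀, delta V' ℓ v =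
      ∑ v ∈ S₀, ((if φ (Rat.HeightOneSpectrum.natGenerator v : ZMod m) =
            (Rat.HeightOneSpectrum.natGenerator v : ZMod ℓ)
          then sFactor ℓ (Rat.HeightOneSpectrum.natGenerator v) else 0) +
        (if ψ (Rat.HeightOneSpectrum.natGenerator v : ZMod d) =
            (Rat.HeightOneSpectrum.natGenerator v : ZMod ℓ)
          then sFactor ℓ (Rat.HeightOneSpectrum.natGenerator v) else 0))) :
    BSDp V ℓ ∧ MissingUpperBoundAt V ℓ :=
  EisensteinPrimesMazurMCOnCellBTwistbackKLFlatPartnerUnitsPsi.missingUpperBoundAt_of_cellC_of_not_split_of_bernoulliUnit_isogenous'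
    hP hDis h311 V ℓ hcV hns V' hiso S₀ Φ₀ m φ d ψ hΦ hram heven hφ hψ hℓm hℓd hφ0 hψ0 hS₀p hS
    (apply_natCast_mul_inv_eq_inv_apply hΦ φ ψ hφ0 hψ0 hφ hψ) hB hbal

/-! ## §2. PER PAIR, NON-SPLIT X2b: Mazur's MC from STEP L + ONE admissible `K` + ONE unit — character hypotheses discharged -/

/-- **PER PAIR, NON-SPLIT: Mazur's main conjecture at an X2b pair `(W, p)` — p645771 §3 WITHOUT the hypotheses
`ψ(p) ≠ 1` (p650639) and `φ(a)a⁻¹ = ψ⁻¹(a)` (the Weil relation, now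
`EisensteinPrimesLineCharactersWeilRelation.apply_natCast_mul_inv_eq_inv_apply`)**. Inputs otherwise verbatim: `PublishedInputs`, Disegni Thm. 4(1), GV Thm. (3.11), STEP L at ONE
Heegner datum (`hlow`), ONE admissible `K` with `r_an(E^{(d_K)}) = 1`, the carrier's line datum with primitive
characters and the Weil relation, ONE Bernoulli unit, local balance `1`. BSD / MC proved for no curve
unconditionally. [cite: JetchevSkinnerWan2017, §7.4.1] [cite: GreenbergVatsal2000, §3 Thm. (3.11) (p. 43) and §2 pp. 14–15, 28]
[cite: Washington1997, Thm. 4.17 and Thm. 5.11] [cite: Disegni2020, Thm. 4 (§3.2)] [cite: Wuthrich2014, Thm. 16 (p. 397)]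
[cite: SilvermanATAEC1994, Ch. V Lemma 5.2 (c), Thm. 5.3 (a),(b), Cor. 5.4 (held copy PDF pp. 406–410)] -/
theorem mazurMainConjectureAt_of_cellB_of_not_split_of_indexLowerBoundAt_of_bernoulliUnit_twist''
    (hP : EisensteinPrimes.PublishedInputs) (hDis : padicBSD_rankOne_nonsplitMult)
    (h311 : thm311_hasUnitContent_iff_and_order_eq_of_lineRamifiedEven)
    (W : WeierstrassCurve ℚ) [W.IsElliptic] [W.IsGloballyMinimal] (p : ℕ) [Fact p.Prime]
    (hc : X2.CellB W p) (hns : ¬ W.HasSplitMultiplicativeReductionAtPrime p)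
    (N : ℕ) [NeZero N] (K : Type) [Field K] [NumberField K]
    (Dt : ModularParametrizationData W N) (H : HeegnerDatum N (NumberField.discr K)) (ι : K →+* ℂ)
    (P : (W.baseChange K).toAffine.Point)
    (hK : IsImaginaryQuadratic K) (hodd : Odd (NumberField.discr K)) (hlt : NumberField.discr K < -4)
    (hN : W.conductorNorm ℤ = N) (hHN : SatisfiesHeegnerHypothesis N K)
    (hHp : SatisfiesHeegnerHypothesis p K)
    (hPt : WeierstrassCurve.Affine.Point.map ι.toRatAlgHom P = heegnerPointComplex Dt H)
    (hcM : ¬ (p : ℤ) ∣ Dt.c)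
    (Wd : WeierstrassCurve ℚ) [Wd.IsElliptic] [Wd.IsGloballyMinimal]
    (hWd : ∃ C : VariableChange ℚ, C • Wd = W.quadraticTwist (NumberField.discr K : ℚ))
    (hrd : Wd.analyticRank = 1)
    (hlow : Finite (W.baseChange K).sha → X11b.IndexLowerBoundAt W p K P)
    (V' : WeierstrassCurve ℚ) [V'.IsElliptic] [V'.IsGloballyMinimal] (hiso : IsIsogenous Wd V')
    (S₀ : Finset (HeightOneSpectrum (𝓞 ℚ))) (Φ₀ : AddSubgroup (V'.geomTorsion (p : ℤ)))
    (m : ℕ) [NeZero m] (φ : DirichletCharacter (ZMod p) m)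
    (d : ℕ) [NeZero d] (ψ : DirichletCharacter (ZMod p) d)
    (hΦ : IsRationalLine V' p Φ₀) (hram : ¬ LineUnramifiedAt V' p Φ₀) (heven : LineEven V' p Φ₀)
    (hφ : φ.IsPrimitive) (hψ : ψ.IsPrimitive) (hpm : p ∣ m) (hpd : ¬ p ∣ d)
    (hφ0 : ∀ (σ : absoluteGaloisGroup ℚ), ∀ Q ∈ Φ₀,
      σ • Q = (φ ((modNCyclotomicCharacter ℚ m σ : (ZMod m)ˣ) : ZMod m)).val • Q)
    (hψ0 : ∀ (σ : absoluteGaloisGroup ℚ) (Q : V'.geomTorsion (p : ℤ)),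
      σ • Q - (ψ ((modNCyclotomicCharacter ℚ d σ : (ZMod d)ˣ) : ZMod d)).val • Q ∈ Φ₀)
    (hS₀p : ∀ v ∈ S₀, ((p : ℕ) : 𝓞 ℚ) ∉ v.asIdeal)
    (hS : ∀ v : HeightOneSpectrum (𝓞 ℚ), v ∉ S₀ → ((p : ℕ) : 𝓞 ℚ) ∉ v.asIdeal → V'.HasGoodReductionAt v)
    (hB : ‖twistedBernoulli p 1 d (fun a : ℕ ↦ teichmullerLift p (ψ (a : ZMod d))⁻¹)‖ = 1)
    (hbal : 1 + ∑ v ∈ S₀, delta V' p v =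
      ∑ v ∈ S₀, ((if φ (Rat.HeightOneSpectrum.natGenerator v : ZMod m) =
            (Rat.HeightOneSpectrum.natGenerator v : ZMod p)
          then sFactor p (Rat.HeightOneSpectrum.natGenerator v) else 0) +
        (if ψ (Rat.HeightOneSpectrum.natGenerator v : ZMod d) =
            (Rat.HeightOneSpectrum.natGenerator v : ZMod p)
          then sFactor p (Rat.HeightOneSpectrum.natGenerator v) else 0))) :
    X2.MazurMainConjectureAt W p :=
  EisensteinPrimesMazurMCOnCellBTwistbackKLFlatPartnerUnitsPsi.mazurMainConjectureAt_of_cellB_of_not_split_of_indexLowerBoundAt_of_bernoulliUnit_twist'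
    hP hDis h311 W p hc hns N K Dt H ι P hK hodd hlt hN hHN hHp hPt hcM Wd hWd hrd hlow V' hiso S₀ Φ₀ m φ d ψ hΦ hram
    heven hφ hψ hpm hpd hφ0 hψ0 hS₀p hS (apply_natCast_mul_inv_eq_inv_apply hΦ φ ψ hφ0 hψ0 hφ hψ) hB hbal

end Summit.BirchSwinnertonDyer.BirchSwinnertonDyer.Theorems.EisensteinPrimesMazurMCOnCellBTwistbackKLFlatPartnerUnitsWeil

end
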